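import Mathlib
import Summits.Ventures.PercRepro2.SwOutHullSplitGTyped

/-!
# The hull split on the general doubly typed side, restricted by a predicate (blind cell PercRepro2,
night-4 g34, 2026-08-28; proofs/NIGHT4-G34.md §2)

g32's hull split `card_le_g_of_hullSplit` decomposes the rigid counting inequality on the general
doubly typed side `gOutSide` of a class `(U, ξ)` at a vertex `p` into the inequalities on the
classes of `U ∖ {p}` and the inequality on the part `{p ∈ hull(h)}`.  The same fibre argument
works for the inequality RESTRICTED to any predicate `P` on configurations (a condition on the
configuration alone, like the five conditions of the side): **`card_le_g_of_hullSplit_pred`**.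
The instance of record is the IN-HULL predicate «every vertex of `S` lies in the hull of `h`»
(`card_le_g_of_hullSplit_inHull`): the inequality on the part `{S ⊆ hull(h)}` of
`(U, ξ)` follows from the inequality on the parts `{S ⊆ hull(h)}` of the classes of `U ∖ {p}` and
the inequality on the part `{S ∪ {p} ⊆ hull(h)}` of `(U, ξ)` — the ITERATED hull split, which
reduces a region with several junctions to the regions with fewer junctions and the parts where
every remaining junction lies in the hull of `h`.
-/

namespace Summit.Ventures.PercRepro2

namespace LocRows

open Hull

variable {V : Type*} {E : Type*} [Fintype E] [DecidableEq E]

open scoped Classical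

section HullSplitPred

variable {ends : E → Sym2 V} {U : Set V} {ξ : Config E} {l h p : V}
  {𝓤 𝓓 𝓓'' : Set (Set V)} {X : Set V} {𝓤' : Set (Set V)}

/-- **The hull split restricted by a predicate**: the rigid counting inequality on the part `P`
of `gOutSide` of `(U, ξ)` follows from the inequality on the part `P` of every class of `U ∖ {p}`
(for the outside colourings extending `ξ`) together with the inequality on the part
`{p ∈ hull(h)} ∩ P` alone. -/
theorem card_le_g_of_hullSplit_pred (P : Config E → Prop)
    (hsub : ∀ ξ' : Config E, (∀ e, e ∉ touches ends U → ξ' e = ξ e) →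
      ∀ 𝓔 : Set (Set E), IsUpperSet 𝓔 →
        ((gOutSide ends l h 𝓤 𝓓 𝓓'' X 𝓤' (U \ {p}) ξ').filter fun ζ =>
            P ζ ∧ redEdges ends ζ h ∈ 𝓔).card ≤
          ((gOutSide ends l h 𝓤 𝓓 𝓓'' X 𝓤' (U \ {p}) ξ').filter fun ζ =>
            P ζ ∧ blueEdges ends ζ h ∈ 𝓔).card)
    (hin : ∀ 𝓔 : Set (Set E), IsUpperSet 𝓔 →
      ((gOutSide ends l h 𝓤 𝓓 𝓓'' X 𝓤' U ξ).filter fun ζ =>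
          p ∈ hull ends ζ h ∧ P ζ ∧ redEdges ends ζ h ∈ 𝓔).card ≤
        ((gOutSide ends l h 𝓤 𝓓 𝓓'' X 𝓤' U ξ).filter fun ζ =>
          p ∈ hull ends ζ h ∧ P ζ ∧ blueEdges ends ζ h ∈ 𝓔).card)
    {𝓔 : Set (Set E)} (h𝓔 : IsUpperSet 𝓔) :
    ((gOutSide ends l h 𝓤 𝓓 𝓓'' X 𝓤' U ξ).filter fun ζ => P ζ ∧ redEdges ends ζ h ∈ 𝓔).card ≤
      ((gOutSide ends l h 𝓤 𝓓 𝓓'' X 𝓤' U ξ).filter fun ζ => P ζ ∧ blueEdges ends ζ h ∈ 𝓔).card := by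
  have hsplit : ∀ (P' : Config E → Prop) [DecidablePred P'],
      ((gOutSide ends l h 𝓤 𝓓 𝓓'' X 𝓤' U ξ).filter fun ζ => P' ζ).card =
        ((gOutSide ends l h 𝓤 𝓓 𝓓'' X 𝓤' U ξ).filter fun ζ => p ∈ hull ends ζ h ∧ P' ζ).card +
          ((gOutSide ends l h 𝓤 𝓓 𝓓'' X 𝓤' U ξ).filter fun ζ => p ∉ hull ends ζ h ∧ P' ζ).card := by
    intro P' _
    rw [← Finset.card_filter_add_card_filter_not (s := (gOutSide ends l h 𝓤 𝓓 𝓓'' X 𝓤' U ξ).filter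
      fun ζ => P' ζ) (p := fun ζ => p ∈ hull ends ζ h)]
    simp only [Finset.filter_filter]
    congr 1 <;> congr 1 <;> ext ζ <;> simp only [and_comm]
  have hR := hsplit (fun ζ => P ζ ∧ redEdges ends ζ h ∈ 𝓔)
  have hB := hsplit (fun ζ => P ζ ∧ blueEdges ends ζ h ∈ 𝓔)
  rw [hR, hB]
  refine Nat.add_le_add (hin 𝓔 h𝓔) ?_
  let key : Config E → Config E := outerOf ends U p ξ
  let S₀ : Finset (Config E) :=
    ((gOutSide ends l h 𝓤 𝓓 𝓓'' X 𝓤' U ξ).filter fun ζ => p ∉ hull ends ζ h).image key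
  have hmap : ∀ (P' : Config E → Prop) [DecidablePred P'] (ζ : Config E),
      ζ ∈ (gOutSide ends l h 𝓤 𝓓 𝓓'' X 𝓤' U ξ).filter (fun ζ => p ∉ hull ends ζ h ∧ P' ζ) →
        key ζ ∈ S₀ := by
    intro P' _ ζ hζ
    rw [Finset.mem_filter] at hζ
    exact Finset.mem_image_of_mem key (Finset.mem_filter.2 ⟨hζ.1, hζ.2.1⟩)
  rw [Finset.card_eq_sum_card_fiberwise (hmap (fun ζ => P ζ ∧ redEdges ends ζ h ∈ 𝓔)),
    Finset.card_eq_sum_card_fiberwise (hmap (fun ζ => P ζ ∧ blueEdges ends ζ h ∈ 𝓔))]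
  refine Finset.sum_le_sum fun k hk => ?_
  obtain ⟨ζ₁, hζ₁, rfl⟩ := Finset.mem_image.1 hk
  have hcl₁ : ζ₁ ∈ outClass ends U h ξ := (mem_gOutSide.1 (Finset.mem_filter.1 hζ₁).1).2
  have hfib : ∀ (P' : Config E → Prop) [DecidablePred P'],
      ((gOutSide ends l h 𝓤 𝓓 𝓓'' X 𝓤' U ξ).filter (fun ζ => p ∉ hull ends ζ h ∧ P' ζ)).filter
          (fun ζ => key ζ = key ζ₁) =
        (gOutSide ends l h 𝓤 𝓓 𝓓'' X 𝓤' (U \ {p}) (outerOf ends U p ξ ζ₁)).filter fun ζ => P' ζ := by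
    intro P' _
    ext ζ
    simp only [Finset.mem_filter]
    constructor
    · rintro ⟨⟨hζ, hp, hP⟩, hkey⟩
      exact ⟨(mem_gOutSide_sdiff_iff hcl₁).1 ⟨hζ, hp, hkey⟩, hP⟩
    · rintro ⟨hζ, hP⟩
      obtain ⟨hζ', hp, hkey⟩ := (mem_gOutSide_sdiff_iff (l := l) (𝓤 := 𝓤) (𝓓 := 𝓓) (𝓓'' := 𝓓'')
        (X := X) (𝓤' := 𝓤') hcl₁).2 hζ
      exact ⟨⟨hζ', hp, hP⟩, hkey⟩
  rw [hfib (fun ζ => P ζ ∧ redEdges ends ζ h ∈ 𝓔), hfib (fun ζ => P ζ ∧ blueEdges ends ζ h ∈ 𝓔)]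
  exact hsub (outerOf ends U p ξ ζ₁) (outerOf_agree hcl₁) 𝓔 h𝓔

/-- **THE ITERATED HULL SPLIT**: the rigid counting inequality on the part `{S ⊆ hull(h)}` of
`gOutSide` of `(U, ξ)` follows from the inequality on the parts `{S ⊆ hull(h)}` of the classes of
`U ∖ {p}` together with the inequality on the part `{S ∪ {p} ⊆ hull(h)}` of `(U, ξ)` (the in-hull
condition «every vertex of `S` lies in the hull of `h`» written out; no new definition). -/
theorem card_le_g_of_hullSplit_inHull (S : Set V)
    (hsub : ∀ ξ' : Config E, (∀ e, e ∉ touches ends U → ξ' e = ξ e) →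
      ∀ 𝓔 : Set (Set E), IsUpperSet 𝓔 →
        ((gOutSide ends l h 𝓤 𝓓 𝓓'' X 𝓤' (U \ {p}) ξ').filter fun ζ =>
            (∀ s ∈ S, s ∈ hull ends ζ h) ∧ redEdges ends ζ h ∈ 𝓔).card ≤
          ((gOutSide ends l h 𝓤 𝓓 𝓓'' X 𝓤' (U \ {p}) ξ').filter fun ζ =>
            (∀ s ∈ S, s ∈ hull ends ζ h) ∧ blueEdges ends ζ h ∈ 𝓔).card)
    (hin : ∀ 𝓔 : Set (Set E), IsUpperSet 𝓔 →
      ((gOutSide ends l h 𝓤 𝓓 𝓓'' X 𝓤' U ξ).filter fun ζ =>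
          (∀ s ∈ insert p S, s ∈ hull ends ζ h) ∧ redEdges ends ζ h ∈ 𝓔).card ≤
        ((gOutSide ends l h 𝓤 𝓓 𝓓'' X 𝓤' U ξ).filter fun ζ =>
          (∀ s ∈ insert p S, s ∈ hull ends ζ h) ∧ blueEdges ends ζ h ∈ 𝓔).card)
    {𝓔 : Set (Set E)} (h𝓔 : IsUpperSet 𝓔) :
    ((gOutSide ends l h 𝓤 𝓓 𝓓'' X 𝓤' U ξ).filter fun ζ =>
        (∀ s ∈ S, s ∈ hull ends ζ h) ∧ redEdges ends ζ h ∈ 𝓔).card ≤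
      ((gOutSide ends l h 𝓤 𝓓 𝓓'' X 𝓤' U ξ).filter fun ζ =>
        (∀ s ∈ S, s ∈ hull ends ζ h) ∧ blueEdges ends ζ h ∈ 𝓔).card := by
  refine card_le_g_of_hullSplit_pred (fun ζ => ∀ s ∈ S, s ∈ hull ends ζ h) hsub
    (fun 𝓔 h𝓔 => ?_) h𝓔
  have := hin 𝓔 h𝓔
  simp only [Set.mem_insert_iff, forall_eq_or_imp, and_assoc] at this
  exact this

/-- The unrestricted inequality is the in-hull inequality at `S = ∅`. -/
theorem card_le_g_of_inHull_empty
    (hin : ∀ 𝓔 : Set (Set E), IsUpperSet 𝓔 →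
      ((gOutSide ends l h 𝓤 𝓓 𝓓'' X 𝓤' U ξ).filter fun ζ =>
          (∀ s ∈ (∅ : Set V), s ∈ hull ends ζ h) ∧ redEdges ends ζ h ∈ 𝓔).card ≤
        ((gOutSide ends l h 𝓤 𝓓 𝓓'' X 𝓤' U ξ).filter fun ζ =>
          (∀ s ∈ (∅ : Set V), s ∈ hull ends ζ h) ∧ blueEdges ends ζ h ∈ 𝓔).card)
    {𝓔 : Set (Set E)} (h𝓔 : IsUpperSet 𝓔) :
    ((gOutSide ends l h 𝓤 𝓓 𝓓'' X 𝓤' U ξ).filter fun ζ => redEdges ends ζ h ∈ 𝓔).card ≤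
      ((gOutSide ends l h 𝓤 𝓓 𝓓'' X 𝓤' U ξ).filter fun ζ => blueEdges ends ζ h ∈ 𝓔).card := by
  have := hin 𝓔 h𝓔
  simpa only [Set.mem_empty_iff_false, false_imp_iff, implies_true, true_and] using this

end HullSplitPred

end LocRows

end Summit.Ventures.PercRepro2
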